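import Summits.AtomisticToContinuum.Crystallization.Theorems.FrustratedLawDichotomySymSharingA

/-!
# FrustratedLawDichotomy · crux `AperiodicFrustratedLawGap` (stmt-AtomisticToContinuum-27623) — THE SYMMETRIC SHARING LEDGER, part B (§4–§6; sequel of
# `…FrustratedLawDichotomySymSharingA`, whose module docstring describes the whole node: lens-5 g121, GO (473) r1939)

Split for the 400-line cap by the landing lane (hand-2 g50); same namespace; all FQNs unchanged; bodies byte-identical to the audited node ab8ae923.
0 sorry; standard axioms.
-/

noncomputable section

namespace Summit.AtomisticToContinuum.Crystallization.Theorems.FrustratedLawDichotomySymSharing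

open MeasureTheory Metric Set Filter ProbabilityTheory
open scoped ENNReal BigOperators
open Literature.MathematicalPhysics.StatisticalMechanics Literature.Probability.Process
open Literature.Probability.Process.LocalConfig (finite_inter_of_separated)
open Summit.AtomisticToContinuum.Crystallization.Theorems.ChargedEnergyGapNegative (E3 eStar)
open Summit.AtomisticToContinuum.Crystallization.Theorems.FrustratedLawDichotomyFiniteClusterGap (ae_mem_of_sep exists_kernel_eq_count_restrict
  measurable_kernel_map_sub lintegral_count_restrict_of_finite)
open Summit.AtomisticToContinuum.Crystallization.Theorems.FrustratedLawDichotomySignedLedger (net)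
open Summit.AtomisticToContinuum.Crystallization.Theorems.FrustratedLawDichotomyTransportPriceLocal (rootEnergy_add_c0_nonneg rootEnergy_le_C0)
open Summit.AtomisticToContinuum.Crystallization.Theorems.FrustratedLawDichotomyTransportPriceSurplus (exists_measurable_rootEnergy_surrogate)
open Summit.AtomisticToContinuum.Crystallization.Theorems.FrustratedLawDichotomyAtlasReach
  (reach NoAdmissibleMinimiserWith CoherentMassExclusion OffAtlasMassGap aperiodicFrustratedLawGap_of_massSplit)
open Summit.AtomisticToContinuum.Crystallization.Theorems.FrustratedLawDichotomyAtlasReachLedger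
  (net_nullLedger coherentMassExclusion_of_floorsL offAtlasMass_ge_of_floorsL)


/-! ## §4. The reach theorem, the energy–mass inequality and the junction to the crux — in symmetric currency -/

/-- ★★ **THE REACH THEOREM WITH THE SYMMETRIC SHARING LEDGER.**  For any radius `r > 0`: row floors `e⋆ + m_i ≤ symAvgEnergy r μ` at the rooted
`7/10`-hard-core Nash configurations of row `i < n` (margins `≥ m > 0`), and the cap `e⋆ − symAvgEnergy r μ ≤ D` (`D ≥ 0`) ONLY at rooted `7/10`-hard-core
Nash configurations outside every row, prove F(η) `CoherentMassExclusion n K η` for every `η ≤ reach m D`. [new: junction] -/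
theorem coherentMassExclusion_of_symAvg {r : ℝ} (hr : 0 < r) (n : ℕ) (K : ℕ → Set (MeasureTheory.Measure (EuclideanSpace ℝ (Fin 3))))
    (hK : ∀ i, MeasurableSet (K i)) (mK : ℕ → ℝ)
    (hfloorS : ∀ i < n, ∀ μ : Measure E3, IsRootedHardCore (7 / 10) μ →
      (∀ p : E3, μ {p} ≠ 0 → ∀ y : E3, (∀ q : E3, μ {q} ≠ 0 → q ≠ p → y ≠ q) →
        ∑' q : {q : E3 // μ {q} ≠ 0 ∧ q ≠ p}, lennardJones (dist p (q : E3)) ≤ ∑' q : {q : E3 // μ {q} ≠ 0 ∧ q ≠ p}, lennardJones (dist y (q : E3))) →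
      μ ∈ K i → eStar + mK i ≤ symAvgEnergy r μ)
    {m D : ℝ} (hm0 : 0 < m) (hD : 0 ≤ D) (hm : ∀ i < n, m ≤ mK i)
    (hcapS : ∀ μ : Measure E3, IsRootedHardCore (7 / 10) μ →
      (∀ p : E3, μ {p} ≠ 0 → ∀ y : E3, (∀ q : E3, μ {q} ≠ 0 → q ≠ p → y ≠ q) →
        ∑' q : {q : E3 // μ {q} ≠ 0 ∧ q ≠ p}, lennardJones (dist p (q : E3)) ≤ ∑' q : {q : E3 // μ {q} ≠ 0 ∧ q ≠ p}, lennardJones (dist y (q : E3))) →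
      μ ∉ (⋃ i ∈ Finset.range n, K i) → eStar - symAvgEnergy r μ ≤ D)
    {η : ℝ} (hη : η ≤ reach m D) : CoherentMassExclusion n K η := by
  obtain ⟨H, hHm, hH⟩ := exists_measurable_rootEnergy_surrogate (-(250 / 12 * (10 / 7) ^ 6))
  refine coherentMassExclusion_of_floorsL n K hK mK (net (symShare r H) fun _ _ => 0) (symShare_nullLedger hr hHm hH)
    (fun i hi μ hμ hN hμi => ?_) hm0 hD hm (fun μ hμ hN hμU => ?_) hη
  · rw [transported_eq_symAvgEnergy hr hH hμ]
    exact hfloorS i hi μ hμ hN hμi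
  · rw [sub_sub, transported_eq_symAvgEnergy hr hH hμ]
    exact hcapS μ hμ hN hμU

/-- ★★ JUNCTION TO THE CRUX: symmetric-currency floors, the symmetric-currency cap off the rows, and A(η) = `OffAtlasMassGap n K η` (`η ≤ reach m D`)
prove `AperiodicFrustratedLawGap` ((404) `aperiodicFrustratedLawGap_of_massSplit`, by name). [new: junction] -/
theorem aperiodicFrustratedLawGap_of_offAtlasMassGap_symAvg {r : ℝ} (hr : 0 < r) (n : ℕ)
    (K : ℕ → Set (MeasureTheory.Measure (EuclideanSpace ℝ (Fin 3)))) (hK : ∀ i, MeasurableSet (K i)) (mK : ℕ → ℝ)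
    (hfloorS : ∀ i < n, ∀ μ : Measure E3, IsRootedHardCore (7 / 10) μ →
      (∀ p : E3, μ {p} ≠ 0 → ∀ y : E3, (∀ q : E3, μ {q} ≠ 0 → q ≠ p → y ≠ q) →
        ∑' q : {q : E3 // μ {q} ≠ 0 ∧ q ≠ p}, lennardJones (dist p (q : E3)) ≤ ∑' q : {q : E3 // μ {q} ≠ 0 ∧ q ≠ p}, lennardJones (dist y (q : E3))) →
      μ ∈ K i → eStar + mK i ≤ symAvgEnergy r μ)
    {m D : ℝ} (hm0 : 0 < m) (hD : 0 ≤ D) (hm : ∀ i < n, m ≤ mK i)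
    (hcapS : ∀ μ : Measure E3, IsRootedHardCore (7 / 10) μ →
      (∀ p : E3, μ {p} ≠ 0 → ∀ y : E3, (∀ q : E3, μ {q} ≠ 0 → q ≠ p → y ≠ q) →
        ∑' q : {q : E3 // μ {q} ≠ 0 ∧ q ≠ p}, lennardJones (dist p (q : E3)) ≤ ∑' q : {q : E3 // μ {q} ≠ 0 ∧ q ≠ p}, lennardJones (dist y (q : E3))) →
      μ ∉ (⋃ i ∈ Finset.range n, K i) → eStar - symAvgEnergy r μ ≤ D)
    {η : ℝ} (hη : η ≤ reach m D) (hA : OffAtlasMassGap n K η) :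
    Summit.AtomisticToContinuum.Crystallization.Theses.FrustratedLawDichotomy.AperiodicFrustratedLawGap :=
  aperiodicFrustratedLawGap_of_massSplit n K η (coherentMassExclusion_of_symAvg hr n K hK mK hfloorS hm0 hD hm hcapS hη) hA

/-- ★ THE ENERGY–MASS INEQUALITY ON THE SYMMETRIC BALL AVERAGE (#132 §4): floors in symmetric currency on the rows (margins `≥ m`), the symmetric-currency
cap off the rows, `0 < m + D` ⟹ every point-stationary probability law that is a.s. rooted `7/10`-hard-core and a.s. Nash with `E_P[rootEnergy] ≤ e⋆ + ε`
gives the uncovered set mass `≥ (m − ε)/(m + D)` — clauses (a)(b)(e) only. [new: junction] -/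
theorem offAtlasMass_ge_of_symAvg {r : ℝ} (hr : 0 < r) (n : ℕ) (K : ℕ → Set (MeasureTheory.Measure (EuclideanSpace ℝ (Fin 3))))
    (hK : ∀ i, MeasurableSet (K i)) (mK : ℕ → ℝ)
    (hfloorS : ∀ i < n, ∀ μ : Measure E3, IsRootedHardCore (7 / 10) μ →
      (∀ p : E3, μ {p} ≠ 0 → ∀ y : E3, (∀ q : E3, μ {q} ≠ 0 → q ≠ p → y ≠ q) →
        ∑' q : {q : E3 // μ {q} ≠ 0 ∧ q ≠ p}, lennardJones (dist p (q : E3)) ≤ ∑' q : {q : E3 // μ {q} ≠ 0 ∧ q ≠ p}, lennardJones (dist y (q : E3))) →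
      μ ∈ K i → eStar + mK i ≤ symAvgEnergy r μ)
    {m D : ℝ} (hmD : 0 < m + D) (hm : ∀ i < n, m ≤ mK i)
    (hcapS : ∀ μ : Measure E3, IsRootedHardCore (7 / 10) μ →
      (∀ p : E3, μ {p} ≠ 0 → ∀ y : E3, (∀ q : E3, μ {q} ≠ 0 → q ≠ p → y ≠ q) →
        ∑' q : {q : E3 // μ {q} ≠ 0 ∧ q ≠ p}, lennardJones (dist p (q : E3)) ≤ ∑' q : {q : E3 // μ {q} ≠ 0 ∧ q ≠ p}, lennardJones (dist y (q : E3))) →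
      μ ∉ (⋃ i ∈ Finset.range n, K i) → eStar - symAvgEnergy r μ ≤ D)
    (P : Measure (Measure E3)) [IsProbabilityMeasure P] (ha : ∀ᵐ μ ∂P, IsRootedHardCore (7 / 10) μ) (hb : IsPointStationaryLaw P)
    (he : ∀ᵐ μ ∂P, ∀ p : E3, μ {p} ≠ 0 → ∀ y : E3, (∀ q : E3, μ {q} ≠ 0 → q ≠ p → y ≠ q) →
      ∑' q : {q : E3 // μ {q} ≠ 0 ∧ q ≠ p}, lennardJones (dist p (q : E3)) ≤ ∑' q : {q : E3 // μ {q} ≠ 0 ∧ q ≠ p}, lennardJones (dist y (q : E3)))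
    {ε : ℝ} (hmean : ∫ μ, rootEnergy lennardJones μ ∂P ≤ eStar + ε) :
    (m - ε) / (m + D) ≤ P.real (⋃ i ∈ Finset.range n, K i)ᶜ := by
  obtain ⟨H, hHm, hH⟩ := exists_measurable_rootEnergy_surrogate (-(250 / 12 * (10 / 7) ^ 6))
  refine offAtlasMass_ge_of_floorsL n K hK mK (net (symShare r H) fun _ _ => 0) (symShare_nullLedger hr hHm hH) (fun i hi μ hμ hN hμi => ?_)
    hmD hm (fun μ hμ hN hμU => ?_) P ha hb he hmean
  · rw [transported_eq_symAvgEnergy hr hH hμ]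
    exact hfloorS i hi μ hμ hN hμi
  · rw [sub_sub, transported_eq_symAvgEnergy hr hH hμ]
    exact hcapS μ hμ hN hμU

/-! ## §5. Legibility: on `count|S` the functional is a finite convex combination of site energies -/

/-- the symmetric weight is finite. -/
theorem symW_ne_top {r : ℝ} (hr : 0 < r) {μ : Measure E3} (hμ : IsRootedHardCore (7 / 10) μ) (y : E3) : symW r μ y ≠ ∞ := by
  unfold symW
  exact ENNReal.inv_ne_top.mpr (lt_max_of_lt_left (pos_iff_ne_zero.mpr (closedBall_ne_zero hr hμ))).ne'

/-- ★ LEGIBILITY.  For `μ = count|S` (`0 ∈ S`, `7/10`-separated) and `T` the finite set of atoms `y ∈ S` with `0 < |y| ≤ r`: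
`symAvgEnergy r μ = e(0)·(1 − Σ_{y∈T} w(y)) + Σ_{y∈T} w(y)·e(y)` with `w(y) = (1/max(#B̄_r(0)∩S, #B̄_r(y)∩S))` and `e(y) = rootEnergy (θ_y μ)` —
what a desk certificate / K-file evaluates; `Σ_T w ≤ 1` (`lintegral_symW_le_one`), so this is a convex combination. [new: bookkeeping] -/
theorem symAvgEnergy_eq_finsum {r : ℝ} (hr : 0 < r) {S : Set E3} (h0S : (0 : E3) ∈ S)
    (hsep : ∀ x ∈ S, ∀ y ∈ S, x ≠ y → (7 / 10 : ℝ) ≤ dist x y) (T : Finset E3) (hT : (T : Set E3) = symPBall r ∩ S) :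
    symAvgEnergy r ((Measure.count : Measure E3).restrict S) =
      rootEnergy lennardJones ((Measure.count : Measure E3).restrict S) *
          (1 - ∑ y ∈ T, (symW r ((Measure.count : Measure E3).restrict S) y).toReal) +
        ∑ y ∈ T, (symW r ((Measure.count : Measure E3).restrict S) y).toReal *
          rootEnergy lennardJones (((Measure.count : Measure E3).restrict S).map fun z : E3 => z - y) := by
  set μ := (Measure.count : Measure E3).restrict S with hμS
  have hμ : IsRootedHardCore (7 / 10) μ := ⟨S, h0S, hsep, rfl⟩
  have hres : μ.restrict (symPBall r) = (Measure.count : Measure E3).restrict (T : Set E3) := by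
    rw [hμS, Measure.restrict_restrict (measurableSet_symPBall r), hT]
  have hsumW : ∫⁻ y in symPBall r, symW r μ y ∂μ = ∑ y ∈ T, symW r μ y := by
    rw [hres, lintegral_count_restrict_of_finite T.finite_toSet, Finset.finite_toSet_toFinset]
  have hsumE : ∫⁻ y in symPBall r, ENNReal.ofReal (rootEnergy lennardJones (μ.map fun z : E3 => z - y) + 250 / 12 * (10 / 7) ^ 6) * symW r μ y ∂μ =
      ∑ y ∈ T, ENNReal.ofReal (rootEnergy lennardJones (μ.map fun z : E3 => z - y) + 250 / 12 * (10 / 7) ^ 6) * symW r μ y := by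
    rw [hres, lintegral_count_restrict_of_finite T.finite_toSet, Finset.finite_toSet_toFinset]
  have hWle : ∑ y ∈ T, symW r μ y ≤ 1 := hsumW ▸ lintegral_symW_le_one hr hμ
  have hWfin : ∀ y ∈ T, symW r μ y ≠ ∞ := fun y _ => symW_ne_top hr hμ y
  have hθ : ∀ y ∈ T, IsRootedHardCore (7 / 10) (μ.map fun z : E3 => z - y) := fun y hy => by
    have hyT : (y : E3) ∈ (T : Set E3) := Finset.mem_coe.mpr hy
    rw [hT] at hyT
    exact hμ.map_sub (by rw [hμS]; exact (count_restrict_singleton_ne_zero_iff S y).mpr hyT.2)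
  have hprod : ∀ y ∈ T, ENNReal.ofReal (rootEnergy lennardJones (μ.map fun z : E3 => z - y) + 250 / 12 * (10 / 7) ^ 6) * symW r μ y ≠ ∞ :=
    fun y hy => ENNReal.mul_ne_top ENNReal.ofReal_ne_top (hWfin y hy)
  have hterm : ∀ y ∈ T, (ENNReal.ofReal (rootEnergy lennardJones (μ.map fun z : E3 => z - y) + 250 / 12 * (10 / 7) ^ 6) * symW r μ y).toReal =
      (rootEnergy lennardJones (μ.map fun z : E3 => z - y) + 250 / 12 * (10 / 7) ^ 6) * (symW r μ y).toReal := fun y hy => by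
    rw [ENNReal.toReal_mul, ENNReal.toReal_ofReal (rootEnergy_add_c0_nonneg (hθ y hy))]
  unfold symAvgEnergy symAvgIn
  rw [hsumW, hsumE, ENNReal.toReal_add (ENNReal.mul_ne_top ENNReal.ofReal_ne_top (ne_top_of_le_ne_top ENNReal.one_ne_top tsub_le_self))
      (ENNReal.sum_ne_top.mpr hprod), ENNReal.toReal_mul, ENNReal.toReal_ofReal (rootEnergy_add_c0_nonneg hμ),
    ENNReal.toReal_sub_of_le hWle ENNReal.one_ne_top, ENNReal.toReal_one, ENNReal.toReal_sum hprod, Finset.sum_congr rfl hterm,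
    ENNReal.toReal_sum hWfin]
  have hsplit : ∑ y ∈ T, (rootEnergy lennardJones (μ.map fun z : E3 => z - y) + 250 / 12 * (10 / 7) ^ 6) * (symW r μ y).toReal =
      ∑ y ∈ T, (symW r μ y).toReal * rootEnergy lennardJones (μ.map fun z : E3 => z - y) + 250 / 12 * (10 / 7) ^ 6 * ∑ y ∈ T, (symW r μ y).toReal := by
    rw [Finset.mul_sum, ← Finset.sum_add_distrib]
    exact Finset.sum_congr rfl fun y _ => by ring
  rw [hsplit]
  ring

/-- the real weights off the root sum to at most `1`. -/
theorem sum_symW_toReal_le_one {r : ℝ} (hr : 0 < r) {S : Set E3} (h0S : (0 : E3) ∈ S)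
    (hsep : ∀ x ∈ S, ∀ y ∈ S, x ≠ y → (7 / 10 : ℝ) ≤ dist x y) (T : Finset E3) (hT : (T : Set E3) = symPBall r ∩ S) :
    ∑ y ∈ T, (symW r ((Measure.count : Measure E3).restrict S) y).toReal ≤ 1 := by
  set μ := (Measure.count : Measure E3).restrict S with hμS
  have hμ : IsRootedHardCore (7 / 10) μ := ⟨S, h0S, hsep, rfl⟩
  have hres : μ.restrict (symPBall r) = (Measure.count : Measure E3).restrict (T : Set E3) := by
    rw [hμS, Measure.restrict_restrict (measurableSet_symPBall r), hT]
  have hsumW : ∫⁻ y in symPBall r, symW r μ y ∂μ = ∑ y ∈ T, symW r μ y := by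
    rw [hres, lintegral_count_restrict_of_finite T.finite_toSet, Finset.finite_toSet_toFinset]
  have hWle : ∑ y ∈ T, symW r μ y ≤ 1 := hsumW ▸ lintegral_symW_le_one hr hμ
  have hWfin : ∀ y ∈ T, symW r μ y ≠ ∞ := fun y _ => symW_ne_top hr hμ y
  rw [← ENNReal.toReal_sum hWfin, ← ENNReal.toReal_one]
  exact ENNReal.toReal_mono ENNReal.one_ne_top hWle

/-- ★ NO LEVERAGE (lower side): a common floor of the site energies over the root's closed `r`-ball is a floor of `symAvgEnergy` — in particular a SITEWISE
certificate `a ≤ e(y)` for the `≤ N_r(0)` atoms of the ball (a K-file output) discharges the symmetric-currency floor / cap at that root. [new: bookkeeping] -/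
theorem symAvgEnergy_ge_of_forall_ge {r : ℝ} (hr : 0 < r) {S : Set E3} (h0S : (0 : E3) ∈ S)
    (hsep : ∀ x ∈ S, ∀ y ∈ S, x ≠ y → (7 / 10 : ℝ) ≤ dist x y) (T : Finset E3) (hT : (T : Set E3) = symPBall r ∩ S) {a : ℝ}
    (h0 : a ≤ rootEnergy lennardJones ((Measure.count : Measure E3).restrict S))
    (hball : ∀ y ∈ T, a ≤ rootEnergy lennardJones (((Measure.count : Measure E3).restrict S).map fun z : E3 => z - y)) :
    a ≤ symAvgEnergy r ((Measure.count : Measure E3).restrict S) := by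
  rw [symAvgEnergy_eq_finsum hr h0S hsep T hT]
  have hs := sum_symW_toReal_le_one hr h0S hsep T hT
  have hW0 : ∀ y ∈ T, 0 ≤ (symW r ((Measure.count : Measure E3).restrict S) y).toReal := fun _ _ => ENNReal.toReal_nonneg
  have h1 : a * (1 - ∑ y ∈ T, (symW r ((Measure.count : Measure E3).restrict S) y).toReal) ≤
      rootEnergy lennardJones ((Measure.count : Measure E3).restrict S) *
        (1 - ∑ y ∈ T, (symW r ((Measure.count : Measure E3).restrict S) y).toReal) :=
    mul_le_mul_of_nonneg_right h0 (sub_nonneg.mpr hs)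
  have h2 : ∑ y ∈ T, (symW r ((Measure.count : Measure E3).restrict S) y).toReal * a ≤
      ∑ y ∈ T, (symW r ((Measure.count : Measure E3).restrict S) y).toReal *
        rootEnergy lennardJones (((Measure.count : Measure E3).restrict S).map fun z : E3 => z - y) :=
    Finset.sum_le_sum fun y hy => mul_le_mul_of_nonneg_left (hball y hy) (hW0 y hy)
  have h3 : a = a * (1 - ∑ y ∈ T, (symW r ((Measure.count : Measure E3).restrict S) y).toReal) +
      ∑ y ∈ T, (symW r ((Measure.count : Measure E3).restrict S) y).toReal * a := by
    rw [← Finset.sum_mul]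
    ring
  linarith

/-- ★ NO LEVERAGE (upper side): a common ceiling of the site energies over the ball is a ceiling of `symAvgEnergy`. [new: bookkeeping] -/
theorem symAvgEnergy_le_of_forall_le {r : ℝ} (hr : 0 < r) {S : Set E3} (h0S : (0 : E3) ∈ S)
    (hsep : ∀ x ∈ S, ∀ y ∈ S, x ≠ y → (7 / 10 : ℝ) ≤ dist x y) (T : Finset E3) (hT : (T : Set E3) = symPBall r ∩ S) {b : ℝ}
    (h0 : rootEnergy lennardJones ((Measure.count : Measure E3).restrict S) ≤ b)
    (hball : ∀ y ∈ T, rootEnergy lennardJones (((Measure.count : Measure E3).restrict S).map fun z : E3 => z - y) ≤ b) :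
    symAvgEnergy r ((Measure.count : Measure E3).restrict S) ≤ b := by
  rw [symAvgEnergy_eq_finsum hr h0S hsep T hT]
  have hs := sum_symW_toReal_le_one hr h0S hsep T hT
  have hW0 : ∀ y ∈ T, 0 ≤ (symW r ((Measure.count : Measure E3).restrict S) y).toReal := fun _ _ => ENNReal.toReal_nonneg
  have h1 : rootEnergy lennardJones ((Measure.count : Measure E3).restrict S) *
        (1 - ∑ y ∈ T, (symW r ((Measure.count : Measure E3).restrict S) y).toReal) ≤
      b * (1 - ∑ y ∈ T, (symW r ((Measure.count : Measure E3).restrict S) y).toReal) :=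
    mul_le_mul_of_nonneg_right h0 (sub_nonneg.mpr hs)
  have h2 : ∑ y ∈ T, (symW r ((Measure.count : Measure E3).restrict S) y).toReal *
        rootEnergy lennardJones (((Measure.count : Measure E3).restrict S).map fun z : E3 => z - y) ≤
      ∑ y ∈ T, (symW r ((Measure.count : Measure E3).restrict S) y).toReal * b :=
    Finset.sum_le_sum fun y hy => mul_le_mul_of_nonneg_left (hball y hy) (hW0 y hy)
  have h3 : b = b * (1 - ∑ y ∈ T, (symW r ((Measure.count : Measure E3).restrict S) y).toReal) +
      ∑ y ∈ T, (symW r ((Measure.count : Measure E3).restrict S) y).toReal * b := by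
    rw [← Finset.sum_mul]
    ring
  linarith

/-! ## §6. The strict door: a strict symmetric-currency gap off the rows needs no residual -/

/-- the atlas extended by one row: the complement of the union of the first `n` rows. -/
def extendRow (n : ℕ) (K : ℕ → Set (MeasureTheory.Measure (EuclideanSpace ℝ (Fin 3)))) : ℕ → Set (MeasureTheory.Measure (EuclideanSpace ℝ (Fin 3))) :=
  fun i => if i < n then K i else (⋃ j ∈ Finset.range n, K j)ᶜ

/-- the margins extended by the gap `g` on the complement row. -/
def extendMargin (n : ℕ) (mK : ℕ → ℝ) (g : ℝ) : ℕ → ℝ := fun i => if i < n then mK i else g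

/-- every row of the extended atlas is measurable. -/
theorem measurableSet_extendRow {n : ℕ} {K : ℕ → Set (MeasureTheory.Measure (EuclideanSpace ℝ (Fin 3)))} (hK : ∀ i, MeasurableSet (K i)) (i : ℕ) :
    MeasurableSet (extendRow n K i) := by
  unfold extendRow
  by_cases hi : i < n
  · rw [if_pos hi]; exact hK i
  · rw [if_neg hi]; exact ((Finset.range n).measurableSet_biUnion fun j _ => hK j).compl

/-- the extended atlas covers everything: the first `n` rows together with their complement. -/
theorem iUnion_extendRow_eq_univ (n : ℕ) (K : ℕ → Set (MeasureTheory.Measure (EuclideanSpace ℝ (Fin 3)))) :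
    (⋃ i ∈ Finset.range (n + 1), extendRow n K i) = univ := by
  refine eq_univ_of_forall fun μ => ?_
  rw [mem_iUnion₂]
  by_cases hμ : μ ∈ ⋃ j ∈ Finset.range n, K j
  · obtain ⟨i, hi, hμi⟩ := mem_iUnion₂.mp hμ
    have hi' : i < n := Finset.mem_range.mp hi
    refine ⟨i, Finset.mem_range.mpr (Nat.lt_succ_of_lt hi'), ?_⟩
    unfold extendRow; rw [if_pos hi']; exact hμi
  · refine ⟨n, Finset.self_mem_range_succ n, ?_⟩
    unfold extendRow; rw [if_neg (lt_irrefl n)]; exact hμ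

/-- an exclusion predicate that fails everywhere excludes every admissible minimiser vacuously. -/
theorem noAdmissibleMinimiserWith_of_forall_not {X : MeasureTheory.Measure (MeasureTheory.Measure (EuclideanSpace ℝ (Fin 3))) → Prop} (hX : ∀ P, ¬ X P) :
    NoAdmissibleMinimiserWith X := by
  intro P
  dsimp only
  intro _ _ _ _ _ _ _ hXP
  exact hX P hXP

/-- ★★ THE STRICT DOOR (A-free).  Symmetric-currency floors on the rows (margins `≥ m > 0`) and a STRICT symmetric-currency gap `e⋆ + g ≤ symAvgEnergy r μ`
(`g > 0`) at every rooted `7/10`-hard-core Nash configuration OUTSIDE the rows prove the crux outright: the complement becomes row `n` of an extended atlas,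
the cap is vacuous (`D = 0`), `reach (min m g) 0 = 1`, and A(1) holds trivially (the uncovered set is empty).  Pointwise STRONGER than the cap slot; UNDECIDED;
its INSTRUMENTABLE reading is «every admissible rooted configuration's `r`-ball carries symmetric-average site energy `≥ e⋆ + g`». [new: junction] -/
theorem aperiodicFrustratedLawGap_of_symGap {r : ℝ} (hr : 0 < r) (n : ℕ) (K : ℕ → Set (MeasureTheory.Measure (EuclideanSpace ℝ (Fin 3))))
    (hK : ∀ i, MeasurableSet (K i)) (mK : ℕ → ℝ)
    (hfloorS : ∀ i < n, ∀ μ : Measure E3, IsRootedHardCore (7 / 10) μ →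
      (∀ p : E3, μ {p} ≠ 0 → ∀ y : E3, (∀ q : E3, μ {q} ≠ 0 → q ≠ p → y ≠ q) →
        ∑' q : {q : E3 // μ {q} ≠ 0 ∧ q ≠ p}, lennardJones (dist p (q : E3)) ≤ ∑' q : {q : E3 // μ {q} ≠ 0 ∧ q ≠ p}, lennardJones (dist y (q : E3))) →
      μ ∈ K i → eStar + mK i ≤ symAvgEnergy r μ)
    {m g : ℝ} (hm0 : 0 < m) (hm : ∀ i < n, m ≤ mK i) (hg : 0 < g)
    (hgapS : ∀ μ : Measure E3, IsRootedHardCore (7 / 10) μ →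
      (∀ p : E3, μ {p} ≠ 0 → ∀ y : E3, (∀ q : E3, μ {q} ≠ 0 → q ≠ p → y ≠ q) →
        ∑' q : {q : E3 // μ {q} ≠ 0 ∧ q ≠ p}, lennardJones (dist p (q : E3)) ≤ ∑' q : {q : E3 // μ {q} ≠ 0 ∧ q ≠ p}, lennardJones (dist y (q : E3))) →
      μ ∉ (⋃ i ∈ Finset.range n, K i) → eStar + g ≤ symAvgEnergy r μ) :
    Summit.AtomisticToContinuum.Crystallization.Theses.FrustratedLawDichotomy.AperiodicFrustratedLawGap := by
  have hU := iUnion_extendRow_eq_univ n K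
  have hF : CoherentMassExclusion (n + 1) (extendRow n K) 1 := by
    refine coherentMassExclusion_of_symAvg hr (n + 1) (extendRow n K) (measurableSet_extendRow hK) (extendMargin n mK g)
      (fun i hi μ hμ hN hμi => ?_) (m := min m g) (D := 0) (lt_min hm0 hg) le_rfl (fun i hi => ?_) (fun μ hμ hN hμU => ?_) (η := 1) ?_
    · by_cases hi' : i < n
      · unfold extendRow at hμi; unfold extendMargin; rw [if_pos hi'] at hμi ⊢
        exact hfloorS i hi' μ hμ hN hμi
      · have hin : i = n := by omega
        subst hin
        unfold extendRow at hμi; unfold extendMargin; rw [if_neg (lt_irrefl i)] at hμi ⊢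
        exact hgapS μ hμ hN hμi
    · unfold extendMargin
      by_cases hi' : i < n
      · rw [if_pos hi']; exact (min_le_left _ _).trans (hm i hi')
      · rw [if_neg hi']; exact min_le_right _ _
    · exact absurd (eq_univ_iff_forall.mp hU μ) hμU
    · unfold reach
      rw [add_zero, div_self (lt_min hm0 hg).ne']
  have hA : OffAtlasMassGap (n + 1) (extendRow n K) 1 := by
    unfold OffAtlasMassGap
    refine noAdmissibleMinimiserWith_of_forall_not fun P hP => ?_
    have hP' : (1 : ℝ) ≤ P.real (⋃ i ∈ Finset.range (n + 1), extendRow n K i)ᶜ := hP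
    rw [hU, compl_univ, measureReal_empty] at hP'
    exact absurd hP' (by norm_num)
  exact aperiodicFrustratedLawGap_of_massSplit (n + 1) (extendRow n K) 1 hF hA

end Summit.AtomisticToContinuum.Crystallization.Theorems.FrustratedLawDichotomySymSharing

end
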